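import Summits.AtomisticToContinuum.BoseEinsteinCondensation.Theorems.BECGroundStateSOSBoundaryTransferWeakHardWallLimitBounded

/-!
# Route `BECGroundStateSOS`, crux `BoundaryTransferWeak` (stmt-AtomisticToContinuum-0827),
# line `rim-squeeze-monotone-coherence`, stub (L) for locally bounded potentials, II:
# the shrink off the collision set and the transfer chain at fixed parameters

Supports (does not close) stmt-AtomisticToContinuum-0827; second auxiliary block of the registered
stub `stub_hardWallLimit_locallyBounded` (lead c3). The landed bounded-`v` chain `transfer_chain`
(`…HardWallLimitChain.lean`: rim-layer cut-off `Φ₁` of a near-minimiser `Ψ` of `H_t`, dilation by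
`s = (L/2)/(L/2 + 4h)`, `L²` moduli) used `v ≤ M` only to control the interaction under dilation
(`energy_dilate_le`). Here the dilation is applied instead to a state `Θ` SUPPORTED OFF THE
`ε₁`-NEIGHBOURHOOD OF THE COLLISION SET (the pair-collision cut state of `Φ₁`, taken as a
hypothesis `hcut` at this level: energy `≤ 𝓔[Φ₁] + τ`, `∫|Θ - Φ₁|² ≤ τ`): dilation by `s ≥ 1/2`
keeps all pairs `> ε₁/2` apart, where `v ≤ C < ⊤` for `v` bounded on every `(δ, ∞)`, so the
interaction of `Θ` and of `Θ_s` is that of the bounded potential `v ⊓ C` and `energy_dilate_le`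
applies verbatim (`energy_dilate_le_of_support`). The resulting chain `transfer_chain_locBdd`
(anchor `stub_hardWallLimit_locallyBounded_chain`) has the bounded-`v` error terms with
`q₁ ↦ q₁ + τ`, `k₁ ↦ k₁ + τ`, `M ↦ C` and one more `√τ` in the distance. All `[folklore]`.
-/

noncomputable section

namespace Summit.AtomisticToContinuum.BoseEinsteinCondensation.RimSqueeze

open Literature.MathematicalPhysics.QuantumManyBody.BoseGas
open MeasureTheory Filter Set
open scoped ENNReal NNReal ComplexConjugate

variable {N : ℕ} {L : ℝ}

/-! ### Shrinking a state supported off the collision set -/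

/-- **Energy of the shrunk state off the collision set.** If `Θ` vanishes wherever some pair is
`ε₁`-close, `v ≤ C < ⊤` on `(r₀, ∞)` and `r₀ ≤ s ε₁`, `0 < s ≤ 1`, then
`energy v Θ_s ≤ s⁻² energy v Θ + N²C · 2‖Θ_s - Θ‖₂`: on the supports of `Θ` and `Θ_s` all pairs
are `> r₀` apart, so both energies are those of the bounded potential `v ⊓ C`, to which
`energy_dilate_le` applies. [folklore] -/
theorem energy_dilate_le_of_support {ℓ : ℝ} {v : ℝ → ℝ≥0∞} (hvm : Measurable v) {C : ℝ≥0∞}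
    (hC : C ≠ ⊤) {r₀ ε₁ : ℝ} (hvC : ∀ r, r₀ < r → v r ≤ C) (Θ : TrialState N ℓ)
    (hΘ : ∀ X, Θ.ψ X ≠ 0 → ∀ i j : Fin N, i ≠ j → ε₁ < dist (X i) (X j))
    {s : ℝ} (hs : 0 < s) (hs1 : s ≤ 1) (hsr : r₀ ≤ s * ε₁) :
    energy v (Θ.dilate hs) ≤ ENNReal.ofReal (s ^ 2)⁻¹ * energy v Θ +
      (N * N : ℝ≥0∞) * C *
        (2 * (∫⁻ Y, (‖(Θ.dilate hs).ψ Y - Θ.ψ Y‖₊ : ℝ≥0∞) ^ 2) ^ (1 / 2 : ℝ)) := by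
  set w : ℝ → ℝ≥0∞ := fun r => min (v r) C with hw
  have hwC : ∀ r, w r ≤ C := fun r => min_le_right _ _
  have hwm : Measurable w := hvm.min measurable_const
  -- the interaction of `Θ_s` is that of `w`
  have hint : ∀ Y, (Θ.dilate hs).ψ Y ≠ 0 → interaction v Y = interaction w Y := by
    intro Y hY
    have hY' : Θ.ψ (s⁻¹ • Y) ≠ 0 := fun h0 => hY (by rw [TrialState.dilate_ψ, h0, mul_zero])
    unfold interaction
    refine Finset.sum_congr rfl fun i _ => Finset.sum_congr rfl fun j hj => ?_
    have hij : i ≠ j := (Finset.mem_filter.1 hj).2.ne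
    have hfar := hΘ _ hY' i j hij
    rw [dist_smul_inv_apply hs] at hfar
    have hd : r₀ < dist (Y i) (Y j) := by
      have := mul_lt_mul_of_pos_left hfar hs
      rw [← mul_assoc, mul_inv_cancel₀ hs.ne', one_mul] at this
      exact hsr.trans_lt this
    exact (min_eq_left (hvC _ hd)).symm
  have hE : energy v (Θ.dilate hs) = energy w (Θ.dilate hs) := by
    unfold energy
    refine lintegral_congr fun Y => ?_
    by_cases hY : (Θ.dilate hs).ψ Y = 0
    · rw [hY, nnnorm_zero, ENNReal.coe_zero, zero_pow two_ne_zero, mul_zero, mul_zero]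
    · rw [hint Y hY]
  have hmono : energy w Θ ≤ energy v Θ :=
    lintegral_mono fun _ => add_le_add le_rfl (mul_le_mul' (Finset.sum_le_sum fun _ _ =>
      Finset.sum_le_sum fun _ _ => min_le_left _ _) le_rfl)
  rw [hE]
  calc energy w (Θ.dilate hs) ≤ ENNReal.ofReal (s ^ 2)⁻¹ * energy w Θ + (N * N : ℝ≥0∞) * C *
        (2 * (∫⁻ Y, (‖(Θ.dilate hs).ψ Y - Θ.ψ Y‖₊ : ℝ≥0∞) ^ 2) ^ (1 / 2 : ℝ)) :=
        energy_dilate_le hwm hC hwC Θ hs hs1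
    _ ≤ _ := by gcongr

/-! ### The transfer chain at fixed parameters -/

/-- **The transfer chain at fixed parameters, locally bounded class.** As `transfer_chain`, with
the boundedness of `v` replaced by: `v ≤ C < ⊤` on `(ε₁/2, ∞)` and a pair-collision cutoff `hcut`
at radius `ε₁` for Dirichlet states of the fattened cube of energy `≤ K₁` (`k₁ ≤ K₁`), costing
`τ` in energy and in `L²` distance squared. Conclusion: the bounded-`v` bounds with `q₁ ↦ q₁ + τ`
(also inside `b₃`), `M ↦ C`, and `√τ` added to the distance. [folklore] -/
theorem transfer_chain_locBdd (hL : 0 < L) {v : ℝ → ℝ≥0∞} (hvm : Measurable v) {C : ℝ≥0∞}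
    (hC : C ≠ ⊤) {ε₁ : ℝ} (hε₁ : 0 ≤ ε₁) (hvC : ∀ r, ε₁ / 2 < r → v r ≤ C) {R₀ : ℝ}
    (hvR : ∀ r, R₀ < r → v r = 0) (hR : L / 2 + R₀ ≤ L) {c₀ : ℝ}
    (hprof : ∀ ℓ' L' : ℝ, 0 < ℓ' → 2 * ℓ' ≤ L' → ∃ q, IsCutoffProfile q ℓ' L' (c₀ / ℓ'))
    {K K₁ τ h η μr δr T₀ σ D a₁ p₁ q₁ k₁ b₃ b₂ : ℝ}
    (hK : groundStateEnergy v N (L / 2) + 1 ≤ ENNReal.ofReal K) (hK0 : 0 ≤ K)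
    (hh : 0 < h) (h8 : 8 * h < L) (hη : 0 < η) (hμ0 : 0 ≤ μr) (hμ : μr ≤ 1 / 2)
    (hδ0 : 0 ≤ δr) (hδ1 : δr ≤ 1) (hT₀ : 0 < T₀) (hKT : K ≤ μr * T₀) (hτ : 0 ≤ τ)
    (hσ : σ = 1 + 8 * h / L) (hD : D = c₀ / (h / 2)) (ha₁ : a₁ = 1 + 2 * μr)
    (hp₁ : p₁ = a₁ * (1 + η)) (hq₁ : q₁ = a₁ * (1 + η⁻¹) * D ^ 2 * (3 * μr))
    (hk₁ : k₁ = p₁ * K + q₁) (hkK₁ : k₁ ≤ K₁)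
    (hb₃ : b₃ = 6 * N * (σ - 1) + 18 * N * (σ - 1) ^ 2 * (L / 2 + 4 * h) ^ 2 * (k₁ + τ))
    (hb₂ : b₂ = 36 * N * h ^ 2 * K)
    (hcut : ∀ Φ : TrialState N (L / 2 + 4 * h), energy v Φ ≤ ENNReal.ofReal K₁ →
      ∃ Θ : TrialState N (L / 2 + 4 * h), energy v Θ ≤ energy v Φ + ENNReal.ofReal τ ∧
        ∫⁻ X, (‖Θ.ψ X - Φ.ψ X‖₊ : ℝ≥0∞) ^ 2 ≤ ENNReal.ofReal τ ∧
        ∀ X, Θ.ψ X ≠ 0 → ∀ i j : Fin N, i ≠ j → ε₁ < dist (X i) (X j))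
    {t : ℝ≥0∞} (ht : ENNReal.ofReal T₀ ≤ t) (Ψ : PeriodicTrialState N L)
    (hΨ : rampEnergy v (rimPot L) t Ψ ≤
      rampGroundStateEnergy v (rimPot L) t N L + ENNReal.ofReal δr) :
    ∃ Φ : TrialState N (L / 2),
      energy v Φ ≤ groundStateEnergy v N (L / 2) +
        ENNReal.ofReal ((σ ^ 2 * p₁ - 1) * K + σ ^ 2 * p₁ * δr + σ ^ 2 * (q₁ + τ) +
          2 * (N * N) * C.toReal * Real.sqrt b₃) ∧
      ∫⁻ X, (‖Φ.ψ X - (cellN N L).indicator Ψ.ψ X‖₊ : ℝ≥0∞) ^ 2 ≤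
        ENNReal.ofReal ((Real.sqrt b₃ + Real.sqrt τ + Real.sqrt (4 * μr) + Real.sqrt b₂) ^ 2) := by
  -- adapted from `transfer_chain` (…HardWallLimitChain)
  -- ### energies along the ramp
  set ED : ℝ≥0∞ := groundStateEnergy v N (L / 2) with hED
  set Et : ℝ≥0∞ := rampGroundStateEnergy v (rimPot L) t N L with hEt
  set Kt : ℝ≥0∞ := Et + ENNReal.ofReal δr with hKt
  have hEtD : Et ≤ ED := rampGroundStateEnergy_le_groundStateEnergy hvR hL (half_le_self hL.le) le_rfl hR t N
  have hδr1 : ENNReal.ofReal δr ≤ 1 := by rw [← ENNReal.ofReal_one]; exact ENNReal.ofReal_le_ofReal hδ1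
  have hKtD : Kt ≤ ED + ENNReal.ofReal δr := add_le_add hEtD le_rfl
  have hKtK : Kt ≤ ENNReal.ofReal K := hKtD.trans ((add_le_add le_rfl hδr1).trans hK)
  have hEDK : ED ≤ ENNReal.ofReal K := le_self_add.trans hK
  have he : periodicEnergy v Ψ ≤ Kt := (periodicEnergy_le_rampEnergy v _ t Ψ).trans hΨ
  have hKE : (∫⁻ X in cellN N L, kineticDensity Ψ.ψ X) ≤ ENNReal.ofReal K :=
    ((lintegral_mono fun X => le_self_add).trans he).trans hKtK
  -- ### the rim mass
  set m : ℝ≥0∞ := ∫⁻ X in cellN N L, (∑ j, rimPot L (X j)) * (‖Ψ.ψ X‖₊ : ℝ≥0∞) ^ 2 with hm_def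
  have hmμ : m ≤ ENNReal.ofReal μr := by
    refine (rimMass_le_ofReal hT₀ ht Ψ hΨ hKtK).trans (ENNReal.ofReal_le_ofReal ?_)
    rw [div_le_iff₀ hT₀]
    exact hKT
  have hμ1 : 0 < 1 - μr := by linarith only [hμ]
  have hm1 : m < 1 := by
    refine hmμ.trans_lt ?_
    rw [← ENNReal.ofReal_one]
    exact (ENNReal.ofReal_lt_ofReal_iff one_pos).2 (by linarith only [hμ])
  -- ### the cut-off state on the fattened cube
  obtain ⟨q, hq⟩ := hprof (h / 2) (L / 2 + 3 * h) (by positivity) (by linarith only [hL, hh])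
  rw [← hD] at hq
  obtain ⟨Φ₁, hE₁, hd₁⟩ := exists_cutoffTrialState hL hh h8 hq v Ψ hm1 hη
  have ha₁0 : 0 < a₁ := by rw [ha₁]; positivity
  have ha₁1 : 1 ≤ a₁ := by rw [ha₁]; linarith only [hμ0]
  have ha₁inv : (1 - μr)⁻¹ ≤ a₁ := by
    rw [ha₁, inv_le_iff_one_le_mul₀ hμ1]
    nlinarith only [hμ0, hμ]
  have hp₁0 : 0 ≤ p₁ := by rw [hp₁]; positivity
  have hq₁0 : 0 ≤ q₁ := by rw [hq₁]; positivity
  have hk₁0 : 0 ≤ k₁ := by rw [hk₁]; positivity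
  have hinv : (1 - m)⁻¹ ≤ ENNReal.ofReal a₁ := by
    have h1 : ENNReal.ofReal (1 - μr) ≤ 1 - m := by
      rw [ENNReal.ofReal_sub 1 hμ0, ENNReal.ofReal_one]
      exact tsub_le_tsub_left hmμ 1
    calc (1 - m)⁻¹ ≤ (ENNReal.ofReal (1 - μr))⁻¹ := ENNReal.inv_le_inv.2 h1
      _ = ENNReal.ofReal (1 - μr)⁻¹ := by rw [ENNReal.ofReal_inv_of_pos hμ1]
      _ ≤ ENNReal.ofReal a₁ := ENNReal.ofReal_le_ofReal ha₁inv
  have hE₁' : energy v Φ₁ ≤ ENNReal.ofReal p₁ * Kt + ENNReal.ofReal q₁ := by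
    refine hE₁.trans ?_
    calc (1 - m)⁻¹ * ((1 + ENNReal.ofReal η) * periodicEnergy v Ψ +
          (1 + ENNReal.ofReal η⁻¹) * ENNReal.ofReal (D ^ 2) * (3 * m))
        ≤ ENNReal.ofReal a₁ * ((1 + ENNReal.ofReal η) * Kt +
          (1 + ENNReal.ofReal η⁻¹) * ENNReal.ofReal (D ^ 2) * (3 * ENNReal.ofReal μr)) := by
          gcongr
      _ = ENNReal.ofReal p₁ * Kt + ENNReal.ofReal q₁ := by
          have e0 : (1 + ENNReal.ofReal η) = ENNReal.ofReal (1 + η) := by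
            rw [ENNReal.ofReal_add zero_le_one hη.le, ENNReal.ofReal_one]
          have e0' : (1 + ENNReal.ofReal η⁻¹) = ENNReal.ofReal (1 + η⁻¹) := by
            rw [ENNReal.ofReal_add zero_le_one (inv_nonneg.2 hη.le), ENNReal.ofReal_one]
          have e3 : (3 : ℝ≥0∞) * ENNReal.ofReal μr = ENNReal.ofReal (3 * μr) := by
            rw [ENNReal.ofReal_mul (by norm_num), ENNReal.ofReal_ofNat]
          have e2 : ENNReal.ofReal (1 + η⁻¹) * ENNReal.ofReal (D ^ 2) * ENNReal.ofReal (3 * μr) =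
              ENNReal.ofReal ((1 + η⁻¹) * D ^ 2 * (3 * μr)) := by
            rw [← ENNReal.ofReal_mul (by positivity), ← ENNReal.ofReal_mul (by positivity)]
          rw [e0, e0', e3, e2, mul_add, ← mul_assoc, ← ENNReal.ofReal_mul ha₁0.le,
            ← ENNReal.ofReal_mul ha₁0.le, hp₁, hq₁,
            show a₁ * ((1 + η⁻¹) * D ^ 2 * (3 * μr)) = a₁ * (1 + η⁻¹) * D ^ 2 * (3 * μr) by ring]
  have hE₁k : energy v Φ₁ ≤ ENNReal.ofReal k₁ := by
    refine hE₁'.trans ?_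
    rw [hk₁, ENNReal.ofReal_add (by positivity) hq₁0, ENNReal.ofReal_mul hp₁0]
    gcongr
  -- ### the pair-collision cut state
  obtain ⟨Θ, hΘE, hΘd, hΘs⟩ := hcut Φ₁ (hE₁k.trans (ENNReal.ofReal_le_ofReal hkK₁))
  have hqτ : ENNReal.ofReal q₁ + ENNReal.ofReal τ = ENNReal.ofReal (q₁ + τ) :=
    (ENNReal.ofReal_add hq₁0 hτ).symm
  have hΘE' : energy v Θ ≤ ENNReal.ofReal p₁ * Kt + ENNReal.ofReal (q₁ + τ) := by
    rw [← hqτ, ← add_assoc]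
    exact hΘE.trans (add_le_add hE₁' le_rfl)
  have hΘk : energy v Θ ≤ ENNReal.ofReal (k₁ + τ) := by
    rw [ENNReal.ofReal_add hk₁0 hτ]
    exact hΘE.trans (add_le_add hE₁k le_rfl)
  have hKEΘ : (∫⁻ X, kineticDensity Θ.ψ X) ≤ ENNReal.ofReal (k₁ + τ) :=
    (le_self_add.trans_eq (energy_eq_kinetic_add v Θ).symm).trans hΘk
  -- ### the shrink
  set s : ℝ := (L / 2) / (L / 2 + 4 * h) with hs
  have hs0 : 0 < s := by rw [hs]; positivity
  have hs1 : s ≤ 1 := by rw [hs, div_le_one (by positivity)]; linarith only [hh]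
  have hsl : s * (L / 2 + 4 * h) = L / 2 := by rw [hs]; field_simp
  have hsσ : s⁻¹ = σ := by rw [hs, hσ, inv_div]; field_simp; ring
  have hσ1 : 0 ≤ σ - 1 := by rw [hσ, add_sub_cancel_left]; positivity
  have hsε : ε₁ / 2 ≤ s * ε₁ := by
    have hs12 : 1 / 2 ≤ s := by
      rw [hs, le_div_iff₀ (by positivity)]
      linarith only [h8]
    calc ε₁ / 2 = 1 / 2 * ε₁ := by ring
      _ ≤ s * ε₁ := mul_le_mul_of_nonneg_right hs12 hε₁
  set Φ₂ : TrialState N (s * (L / 2 + 4 * h)) := Θ.dilate hs0 with hΦ₂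
  have hb₃0 : 0 ≤ b₃ := by rw [hb₃]; positivity
  have hb₂0 : 0 ≤ b₂ := by rw [hb₂]; positivity
  have hd₃ : ∫⁻ Y, (‖Φ₂.ψ Y - Θ.ψ Y‖₊ : ℝ≥0∞) ^ 2 ≤ ENNReal.ofReal b₃ := by
    calc ∫⁻ Y, (‖Φ₂.ψ Y - Θ.ψ Y‖₊ : ℝ≥0∞) ^ 2
        ≤ 2 * ENNReal.ofReal (3 * N * (1 - s)) +
          2 * ((3 * N : ℝ≥0∞) * ENNReal.ofReal (3 * (s⁻¹ - 1) ^ 2 * (L / 2 + 4 * h) ^ 2) *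
            ∫⁻ Y, kineticDensity Θ.ψ Y) := lintegral_dilate_sub_sq_le Θ hs0 hs1
      _ ≤ 2 * ENNReal.ofReal (3 * N * (σ - 1)) +
          2 * ((3 * N : ℝ≥0∞) * ENNReal.ofReal (3 * (σ - 1) ^ 2 * (L / 2 + 4 * h) ^ 2) *
            ENNReal.ofReal (k₁ + τ)) := by
          have h1sσ : 1 - s ≤ σ - 1 := by
            rw [hs, hσ]
            have e : 1 - L / 2 / (L / 2 + 4 * h) = 4 * h / (L / 2 + 4 * h) := by field_simp; ring
            rw [e, add_sub_cancel_left, div_le_div_iff₀ (by positivity) hL]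
            nlinarith only [hh, hL]
          rw [hsσ]; gcongr
      _ = ENNReal.ofReal b₃ := by
          have e3 : (3 * N : ℝ≥0∞) = ENNReal.ofReal (3 * N) := by
            rw [ENNReal.ofReal_mul (by norm_num), ENNReal.ofReal_ofNat, ENNReal.ofReal_natCast]
          have e2 : ∀ x : ℝ, 0 ≤ x → (2 : ℝ≥0∞) * ENNReal.ofReal x = ENNReal.ofReal (2 * x) :=
            fun x _ => by rw [ENNReal.ofReal_mul (by norm_num), ENNReal.ofReal_ofNat]
          rw [e3, ← ENNReal.ofReal_mul (by positivity), ← ENNReal.ofReal_mul (by positivity),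
            e2 _ (by positivity), e2 _ (by positivity),
            ← ENNReal.ofReal_add (by positivity) (by positivity), hb₃]
          congr 1
          ring
  have hE₂ : energy v Φ₂ ≤ ED + ENNReal.ofReal ((σ ^ 2 * p₁ - 1) * K + σ ^ 2 * p₁ * δr +
      σ ^ 2 * (q₁ + τ) + 2 * (N * N) * C.toReal * Real.sqrt b₃) := by
    have h1 := energy_dilate_le_of_support hvm hC hvC Θ hΘs hs0 hs1 hsε
    have hsq : (∫⁻ Y, (‖Φ₂.ψ Y - Θ.ψ Y‖₊ : ℝ≥0∞) ^ 2) ^ (1 / 2 : ℝ) ≤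
        ENNReal.ofReal (Real.sqrt b₃) :=
      l2dist_rpow_half_le (Real.sqrt_nonneg _) (by rwa [Real.sq_sqrt hb₃0])
    have hs2 : ENNReal.ofReal (s ^ 2)⁻¹ = ENNReal.ofReal (σ ^ 2) := by rw [← inv_pow, hsσ]
    have hθ : 1 ≤ σ ^ 2 * p₁ := by
      have h1s : 1 ≤ σ := by linarith only [hσ1]
      have hp : 1 ≤ p₁ := by
        rw [hp₁]
        exact one_le_mul_of_one_le_of_one_le ha₁1 (by linarith only [hη])
      exact one_le_mul_of_one_le_of_one_le (one_le_pow₀ h1s) hp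
    have hC' : C = ENNReal.ofReal C.toReal := (ENNReal.ofReal_toReal hC).symm
    have eI : (N * N : ℝ≥0∞) * C * (2 * ENNReal.ofReal (Real.sqrt b₃)) =
        ENNReal.ofReal (2 * (N * N) * C.toReal * Real.sqrt b₃) := by
      conv_lhs => rw [hC', ← ENNReal.ofReal_natCast, ← ENNReal.ofReal_mul (Nat.cast_nonneg _),
        ← ENNReal.ofReal_mul (by positivity), ← ENNReal.ofReal_ofNat 2,
        ← ENNReal.ofReal_mul (by norm_num), ← ENNReal.ofReal_mul (by positivity)]
      congr 1
      ring
    calc energy v Φ₂ ≤ ENNReal.ofReal (s ^ 2)⁻¹ * energy v Θ +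
          (N * N : ℝ≥0∞) * C * (2 * (∫⁻ Y, (‖Φ₂.ψ Y - Θ.ψ Y‖₊ : ℝ≥0∞) ^ 2) ^ (1 / 2 : ℝ)) := h1
      _ ≤ ENNReal.ofReal (σ ^ 2) * (ENNReal.ofReal p₁ * (ED + ENNReal.ofReal δr) +
          ENNReal.ofReal (q₁ + τ)) + (N * N : ℝ≥0∞) * C * (2 * ENNReal.ofReal (Real.sqrt b₃)) := by
          rw [hs2]
          gcongr
          exact hΘE'.trans (by gcongr)
      _ = ENNReal.ofReal (σ ^ 2 * p₁) * (ED + ENNReal.ofReal δr) + ENNReal.ofReal (σ ^ 2 * (q₁ + τ)) +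
          ENNReal.ofReal (2 * (N * N) * C.toReal * Real.sqrt b₃) := by
          rw [eI, mul_add, ← mul_assoc, ← ENNReal.ofReal_mul (sq_nonneg _),
            ← ENNReal.ofReal_mul (sq_nonneg _)]
      _ ≤ _ := ofReal_mul_add_le_add_ofReal hEDK hK0 hθ hδ0 (by positivity) (by positivity)
  -- ### the distance to the cell cut-off
  set U : Config N := fun _ => (WithLp.toLp 2 fun _ : Fin 3 => -(2 * h) : Space) with hU
  have hΨm : Measurable Ψ.ψ := Ψ.contDiff.continuous.measurable
  have hGUm : Measurable ((cellN N L).indicator fun X => Ψ.ψ (X + U)) :=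
    (hΨm.comp (measurable_id.add_const U)).indicator (measurableSet_cellN N L)
  have hGm : Measurable ((cellN N L).indicator Ψ.ψ) := hΨm.indicator (measurableSet_cellN N L)
  have hd₂ : ∫⁻ X, (‖(cellN N L).indicator (fun X => Ψ.ψ (X + U)) X -
      (cellN N L).indicator Ψ.ψ X‖₊ : ℝ≥0∞) ^ 2 ≤ ENNReal.ofReal b₂ := by
    have e : (fun X => (‖(cellN N L).indicator (fun X => Ψ.ψ (X + U)) X -
        (cellN N L).indicator Ψ.ψ X‖₊ : ℝ≥0∞) ^ 2) =
        (cellN N L).indicator fun X => (‖Ψ.ψ (X + U) - Ψ.ψ X‖₊ : ℝ≥0∞) ^ 2 := by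
      funext X
      by_cases hX : X ∈ cellN N L
      · simp [indicator_of_mem hX]
      · simp [indicator_of_notMem hX]
    rw [e, lintegral_indicator (measurableSet_cellN N L)]
    refine (lintegral_cellN_sub_translate_sq_le hL Ψ U).trans ?_
    calc (3 * N : ℝ≥0∞) * ENNReal.ofReal (‖U‖ ^ 2) * ∫⁻ X in cellN N L, kineticDensity Ψ.ψ X
        ≤ (3 * N : ℝ≥0∞) * ENNReal.ofReal (12 * h ^ 2) * ENNReal.ofReal K := by
          gcongr
          exact norm_shift_sq_le N h
      _ = ENNReal.ofReal b₂ := by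
          rw [hb₂, natCast_eq_ofReal, show (3 : ℝ≥0∞) = ENNReal.ofReal 3 by norm_num,
            ← ENNReal.ofReal_mul (by norm_num), ← ENNReal.ofReal_mul (by positivity),
            ← ENNReal.ofReal_mul (by positivity)]
          congr 1; ring
  have hd₁' : ∫⁻ X, (‖Φ₁.ψ X - (cellN N L).indicator (fun X => Ψ.ψ (X + U)) X‖₊ : ℝ≥0∞) ^ 2 ≤
      ENNReal.ofReal (4 * μr) := by
    refine hd₁.trans ?_
    rw [ENNReal.ofReal_mul (by norm_num : (0 : ℝ) ≤ 4), ENNReal.ofReal_ofNat]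
    gcongr
  have hdist : (∫⁻ X, (‖Φ₂.ψ X - (cellN N L).indicator Ψ.ψ X‖₊ : ℝ≥0∞) ^ 2) ^ (1 / 2 : ℝ) ≤
      ENNReal.ofReal (Real.sqrt b₃ + Real.sqrt τ + Real.sqrt (4 * μr) + Real.sqrt b₂) := by
    have hΦ₂m : Measurable Φ₂.ψ := Φ₂.contDiff.continuous.measurable
    have hΘm : Measurable Θ.ψ := Θ.contDiff.continuous.measurable
    have hΦ₁m : Measurable Φ₁.ψ := Φ₁.contDiff.continuous.measurable
    have t1 := l2dist_triangle hΦ₂m hΘm hGm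
    have t2 := l2dist_triangle hΘm hΦ₁m hGm
    have t3 := l2dist_triangle hΦ₁m hGUm hGm
    have e₃ : (∫⁻ X, (‖Φ₂.ψ X - Θ.ψ X‖₊ : ℝ≥0∞) ^ 2) ^ (1 / 2 : ℝ) ≤ ENNReal.ofReal (Real.sqrt b₃) :=
      l2dist_rpow_half_le (Real.sqrt_nonneg _) (by rwa [Real.sq_sqrt hb₃0])
    have eτ : (∫⁻ X, (‖Θ.ψ X - Φ₁.ψ X‖₊ : ℝ≥0∞) ^ 2) ^ (1 / 2 : ℝ) ≤ ENNReal.ofReal (Real.sqrt τ) :=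
      l2dist_rpow_half_le (Real.sqrt_nonneg _) (by rwa [Real.sq_sqrt hτ])
    have e₁ : (∫⁻ X, (‖Φ₁.ψ X - (cellN N L).indicator (fun X => Ψ.ψ (X + U)) X‖₊ : ℝ≥0∞) ^ 2) ^
        (1 / 2 : ℝ) ≤ ENNReal.ofReal (Real.sqrt (4 * μr)) :=
      l2dist_rpow_half_le (Real.sqrt_nonneg _) (by rwa [Real.sq_sqrt (by positivity)])
    have e₂ : (∫⁻ X, (‖(cellN N L).indicator (fun X => Ψ.ψ (X + U)) X -
        (cellN N L).indicator Ψ.ψ X‖₊ : ℝ≥0∞) ^ 2) ^ (1 / 2 : ℝ) ≤ ENNReal.ofReal (Real.sqrt b₂) :=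
      l2dist_rpow_half_le (Real.sqrt_nonneg _) (by rwa [Real.sq_sqrt hb₂0])
    calc _ ≤ _ := t1
      _ ≤ ENNReal.ofReal (Real.sqrt b₃) + (ENNReal.ofReal (Real.sqrt τ) +
          (ENNReal.ofReal (Real.sqrt (4 * μr)) + ENNReal.ofReal (Real.sqrt b₂))) :=
          add_le_add e₃ (t2.trans (add_le_add eτ (t3.trans (add_le_add e₁ e₂))))
      _ = _ := by
          rw [← ENNReal.ofReal_add (Real.sqrt_nonneg _) (Real.sqrt_nonneg _),
            ← ENNReal.ofReal_add (Real.sqrt_nonneg _) (by positivity),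
            ← ENNReal.ofReal_add (Real.sqrt_nonneg _) (by positivity)]
          congr 1
          ring
  -- ### transport to side `L/2`
  refine ⟨hsl ▸ Φ₂, ?_, ?_⟩
  · rw [energy_eqRec_trialState]
    exact hE₂
  · rw [eqRec_trialState_ψ]
    have hsq : ∀ x : ℝ≥0∞, (x ^ (1 / 2 : ℝ)) ^ 2 = x := fun x => by
      rw [← ENNReal.rpow_two, ← ENNReal.rpow_mul]
      norm_num
    calc ∫⁻ X, (‖Φ₂.ψ X - (cellN N L).indicator Ψ.ψ X‖₊ : ℝ≥0∞) ^ 2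
        = ((∫⁻ X, (‖Φ₂.ψ X - (cellN N L).indicator Ψ.ψ X‖₊ : ℝ≥0∞) ^ 2) ^ (1 / 2 : ℝ)) ^ 2 :=
          (hsq _).symm
      _ ≤ (ENNReal.ofReal (Real.sqrt b₃ + Real.sqrt τ + Real.sqrt (4 * μr) + Real.sqrt b₂)) ^ 2 := by
          gcongr
      _ = _ := by rw [← ENNReal.ofReal_pow (by positivity)]

/-- **Anchor of this block** (quantified form of `transfer_chain_locBdd`). [folklore] -/
theorem stub_hardWallLimit_locallyBounded_chain : ∀ {N : ℕ} {L : ℝ}, 0 < L → ∀ {v : ℝ → ℝ≥0∞}, Measurable v → ∀ {C : ℝ≥0∞}, C ≠ ⊤ → ∀ {ε₁ : ℝ}, 0 ≤ ε₁ → (∀ r, ε₁ / 2 < r → v r ≤ C) → ∀ {R₀ : ℝ}, (∀ r, R₀ < r → v r = 0) → L / 2 + R₀ ≤ L → ∀ {c₀ : ℝ}, (∀ ℓ' L' : ℝ, 0 < ℓ' → 2 * ℓ' ≤ L' → ∃ q, IsCutoffProfile q ℓ' L' (c₀ / ℓ')) → ∀ {K K₁ τ h η μr δr T₀ σ D a₁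 p₁ q₁ k₁ b₃ b₂ : ℝ}, groundStateEnergy v N (L / 2) + 1 ≤ ENNReal.ofReal K → 0 ≤ K → 0 < h → 8 * h < L → 0 < η → 0 ≤ μr → μr ≤ 1 / 2 → 0 ≤ δr → δr ≤ 1 → 0 < T₀ → K ≤ μr * T₀ → 0 ≤ τ → σ = 1 + 8 * h / L → D = c₀ / (h / 2) → a₁ = 1 + 2 * μr → p₁ = a₁ * (1 + η) → q₁ = a₁ * (1 + η⁻¹) * D ^ 2 * (3 * μr) → k₁ = p₁ * K + q₁ → k₁ ≤ K₁ → b₃ = 6 * N * (σ - 1) + 18 * N * (σ - 1) ^ 2 * (L / 2 + 4 * h) ^ 2 * (k₁ + τ) → b₂ = 36 * N * h ^ 2 * K → (∀ Φ : TrialState N (L / 2 + 4 * h), energy v Φ ≤ ENNReal.ofReal K₁ → ∃ Θ : TrialState N (L / 2 + 4 * h), energy v Θ ≤ energy v Φ + ENNReal.ofReal τ ∧ ∫⁻ X : Config N, (‖Θ.ψ X - Φ.ψ X‖₊ : ℝ≥0∞) ^ 2 ≤ ENNReal.ofReal τ ∧ ∀ X, Θ.ψ X ≠ 0 → ∀ i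 j : Fin N, i ≠ j → ε₁ < dist (X i) (X j)) → ∀ {t : ℝ≥0∞}, ENNReal.ofReal T₀ ≤ t → ∀ Ψ : PeriodicTrialState N L, rampEnergy v (rimPot L) t Ψ ≤ rampGroundStateEnergy v (rimPot L) t N L + ENNReal.ofReal δr → ∃ Φ : TrialState N (L / 2), energy v Φ ≤ groundStateEnergy v N (L / 2) + ENNReal.ofReal ((σ ^ 2 * p₁ - 1) * K + σ ^ 2 * p₁ * δr + σ ^ 2 * (q₁ + τ) + 2 * (N * N) * C.toReal * Real.sqrt b₃) ∧ ∫⁻ X : Config N, (‖Φ.ψ X - (cellN N L).indicator Ψ.ψ X‖₊ : ℝ≥0∞) ^ 2 ≤ ENNReal.ofReal ((Real.sqrt b₃ + Real.sqrt τ + Real.sqrt (4 * μr) + Real.sqrt b₂) ^ 2) :=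
  fun hL _ hvm _ hC _ hε₁ hvC _ hvR hR _ hprof _ _ _ _ _ _ _ _ _ _ _ _ _ _ _ _ hK hK0 hh h8 hη hμ0 hμ hδ0 hδ1 hT₀ hKT hτ hσ hD ha₁ hp₁ hq₁ hk₁ hkK₁ hb₃ hb₂ hcut _ ht Ψ hΨ =>
    transfer_chain_locBdd hL hvm hC hε₁ hvC hvR hR hprof hK hK0 hh h8 hη hμ0 hμ hδ0 hδ1 hT₀ hKT hτ hσ hD ha₁ hp₁ hq₁ hk₁ hkK₁ hb₃ hb₂ hcut ht Ψ hΨ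

end Summit.AtomisticToContinuum.BoseEinsteinCondensation.RimSqueeze

end
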